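import Mathlib
import HarnessLib
import Literature.Geometry.DiscreteGeometry.BondGraph
import Literature.Geometry.DiscreteGeometry.KissingPatterns
import Summits.AtomisticToContinuum.Crystallization.Theorems.PricedLinkCensusSoftLayerPropagationBasics
import Summits.AtomisticToContinuum.Crystallization.Theorems.PricedLinkCensusSoftLayerPropagationStubMetricScaled
import Summits.AtomisticToContinuum.Crystallization.Theorems.PricedLinkCensusSoftLayerPropagationStubChartAssembly
import Summits.AtomisticToContinuum.Crystallization.Theorems.PricedLinkCensusSoftLayerPropagationHXPattern
import Summits.AtomisticToContinuum.Crystallization.Theorems.PricedLinkCensusSoftLayerPropagationHXApex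
import Summits.AtomisticToContinuum.Crystallization.Theorems.PricedLinkCensusSoftLayerPropagationHXLensB
import Summits.AtomisticToContinuum.Crystallization.Theorems.PricedLinkCensusSoftLayerPropagationHXLensC
import Summits.AtomisticToContinuum.Crystallization.Theorems.PricedLinkCensusSoftLayerPropagationHXSite

/-!
# Local no-merge at an FCC-type site (crux `SoftLayerPropagation`, line `Sketch`, registered stub `develop_HX_fcc`)

Route `PricedLinkCensus`, crux `SoftLayerPropagation` (stmt-AtomisticToContinuum-14233), line `Sketch`.
Worker file for the registered stub `develop_HX_fcc` (signature verbatim from the registered skeleton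
`Cruxes/SoftLayerPropagation/Lines/Sketch.lean`): hypothesis `HX` of the ordered development
`Theorems.develop_step` at an FCC-type site `x`.  With `u = m p_u`, `k = m p_k` read in the chart of `x`
(integer model `fccInt`), the non-contact pair `(p_u, p_k)` is a square diagonal, hexagon-opposite or
antipodal (`fccInt_noncontact_cases`), and:

* antipodal: the charts put `y_u, y_k` within `nn_x/4` of `y_x ± nn_x A p_u`, so a site bonded to both
  is within `< nn_x` of `y_x` (`hx_antipodal`), against the hard core — vacuous;
* square diagonal: the far apex `z` of the coned square exists (`hx_far_apex`); either `t = z` (and the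
  common neighbour is a corner `a` of the square) or the seven points `{x, z; u, k; a, b}` and `t`, all
  read at the one scale `ℓ = nn_x/(1+η)` with edge ratio `(1+η)³ ≤ 33/32` (`…HXSite`), contradict the
  lens lemma `hx_lens_square_dist`;
* hexagon-opposite: with `w`, `p`, `s` from `fccInt_hexagon` and the far apex `z₁` of the square
  `p w k s`, the octahedron `{x, z₁; p, k; w, s}` pins `dist p k` (`metric_octahedron_dist`) and the lens
  lemma `hx_lens_hexagon_dist` excludes `t` — vacuous.
-/

noncomputable section

namespace Summit.AtomisticToContinuum.Crystallization.Theorems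

open Literature.Geometry.DiscreteGeometry

/-- **develop_HX_fcc** (registered stub; LOCAL NO-MERGE at an FCC-type site = hypothesis `HX` of
`Theorems.develop_step`).  `x` charge-free with an FCC chart, everything within `5/2·nn_x` charge-free
and charted; `u, k` non-bonded neighbours of `x`, `t ∉ star(x)` bonded to both ⇒ some `c` is bonded to
`x, u, k, t`.  Cases by the label distance of `u, k` in the chart of `x`: `2` (antipodal: the charts give
`‖y_u + y_k − 2 y_x‖ ≤ nn_x/2`, so a common neighbour of `u, k` is within `< nn` of `y_x`, i.e. is `x`);
`√2` (square diagonal: `Theorems.metric_octahedron(_apex)` pins the far apex `z` of the octahedron on the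
square, the hard core `dist ≥ max nn` leaves only an arc of `≈ 1°` about `z` on the circle of common
neighbours, so `t = z` and `c` = another corner of the square); `√3` (no such `t`: the two lattice
common neighbours are `x` and a neighbour of `x`, antipodal on a circle of diameter `nn`). -/
theorem develop_HX_fcc :
    ∀ η : ℝ, 0 < η → η ≤ 1 / 100 →
      ∀ (N : ℕ) (y : Fin N → EuclideanSpace ℝ (Fin 3)) (x : Fin N),
        0 < Literature.Geometry.DiscreteGeometry.nearestDist y x →
        (∀ j : Fin N, dist (y x) (y j) ≤ 5 / 2 * Literature.Geometry.DiscreteGeometry.nearestDist y x →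
          Literature.Geometry.DiscreteGeometry.IsChargeFree η y j) →
        (∀ j : Fin N, dist (y x) (y j) ≤ 5 / 2 * Literature.Geometry.DiscreteGeometry.nearestDist y x →
          ∃ (P : Finset (EuclideanSpace ℝ (Fin 3)))
            (A : EuclideanSpace ℝ (Fin 3) →ₗᵢ[ℝ] EuclideanSpace ℝ (Fin 3))
            (m : EuclideanSpace ℝ (Fin 3) → Fin N),
            (P = Literature.Geometry.DiscreteGeometry.fccKissingPattern ∨
              P = Literature.Geometry.DiscreteGeometry.hcpKissingPattern) ∧
            (∀ p ∈ P, (Literature.Geometry.DiscreteGeometry.bondGraph η y).Adj j (m p) ∧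
              dist (y (m p)) (y j + Literature.Geometry.DiscreteGeometry.nearestDist y j • A p) ≤
                Literature.Geometry.DiscreteGeometry.nearestDist y j / 4) ∧
            (∀ p ∈ P, ∀ q ∈ P, m p = m q → p = q) ∧
            (∀ p ∈ P, ∀ q ∈ P,
              ((Literature.Geometry.DiscreteGeometry.bondGraph η y).Adj (m p) (m q) ↔ dist p q = 1)) ∧
            (∀ l, (Literature.Geometry.DiscreteGeometry.bondGraph η y).Adj j l → ∃ p ∈ P, m p = l)) →
        ∀ (A : EuclideanSpace ℝ (Fin 3) →ₗᵢ[ℝ] EuclideanSpace ℝ (Fin 3)) (m : EuclideanSpace ℝ (Fin 3) → Fin N),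
          ((Literature.Geometry.DiscreteGeometry.fccKissingPattern = Literature.Geometry.DiscreteGeometry.fccKissingPattern ∨
            Literature.Geometry.DiscreteGeometry.fccKissingPattern = Literature.Geometry.DiscreteGeometry.hcpKissingPattern) ∧
          (∀ p ∈ Literature.Geometry.DiscreteGeometry.fccKissingPattern, (Literature.Geometry.DiscreteGeometry.bondGraph η y).Adj x (m p) ∧
            dist (y (m p)) (y x + Literature.Geometry.DiscreteGeometry.nearestDist y x • A p) ≤
              Literature.Geometry.DiscreteGeometry.nearestDist y x / 4) ∧
          (∀ p ∈ Literature.Geometry.DiscreteGeometry.fccKissingPattern, ∀ q ∈ Literature.Geometry.DiscreteGeometry.fccKissingPattern, m p = m q → p = q) ∧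
          (∀ p ∈ Literature.Geometry.DiscreteGeometry.fccKissingPattern, ∀ q ∈ Literature.Geometry.DiscreteGeometry.fccKissingPattern,
            ((Literature.Geometry.DiscreteGeometry.bondGraph η y).Adj (m p) (m q) ↔ dist p q = 1)) ∧
          (∀ l, (Literature.Geometry.DiscreteGeometry.bondGraph η y).Adj x l → ∃ p ∈ Literature.Geometry.DiscreteGeometry.fccKissingPattern, m p = l)) →
        ∀ u k t : Fin N, (Literature.Geometry.DiscreteGeometry.bondGraph η y).Adj x u → (Literature.Geometry.DiscreteGeometry.bondGraph η y).Adj x k → ¬ (Literature.Geometry.DiscreteGeometry.bondGraph η y).Adj u k → u ≠ k →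
          ¬ (Literature.Geometry.DiscreteGeometry.bondGraph η y).Adj x t → x ≠ t → (Literature.Geometry.DiscreteGeometry.bondGraph η y).Adj t u → (Literature.Geometry.DiscreteGeometry.bondGraph η y).Adj t k →
          ∃ c : Fin N, (Literature.Geometry.DiscreteGeometry.bondGraph η y).Adj x c ∧ (Literature.Geometry.DiscreteGeometry.bondGraph η y).Adj u c ∧ (Literature.Geometry.DiscreteGeometry.bondGraph η y).Adj k c ∧ (Literature.Geometry.DiscreteGeometry.bondGraph η y).Adj t c := by
  intro η hη0 hη1 N y x hnn _hCF charts A m hx u k t hxu hxk hnuk hneuk hnxt hnext htu htk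
  obtain ⟨-, C2, C3, C4, C5⟩ := hx
  have hη : (0 : ℝ) ≤ η := hη0.le
  have hρ : (0 : ℝ) < 1 + η := by linarith
  /- the scale `ℓ = nn_x/(1+η)` and the edge ratio `(1+η)³ = 1 + ε` -/
  set ℓ := nearestDist y x / (1 + η) with hℓ
  have hℓpos : 0 < ℓ := div_pos hnn hρ
  set ε := (1 + η) ^ 3 - 1 with hε
  have hcube : (1 + η) ^ 3 = 1 + 3 * η + 3 * η ^ 2 + η ^ 3 := by ring
  have hη2 : η ^ 2 ≤ η * (1 / 100) := by nlinarith
  have hη3 : η ^ 3 ≤ η ^ 2 * (1 / 100) := by nlinarith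
  have hε0 : 0 ≤ ε := by rw [hε, hcube]; nlinarith
  have hε1 : ε ≤ 1 / 32 := by rw [hε, hcube]; nlinarith
  have hpow : (1 + η) ^ 3 = 1 + ε := by rw [hε]; ring
  have sx : ℓ ≤ nearestDist y x ∧ nearestDist y x ≤ (1 + η) ^ 2 * ℓ := hx_self_scale hη x
  have star : ∀ {v : Fin N}, (bondGraph η y).Adj x v →
      ℓ ≤ nearestDist y v ∧ nearestDist y v ≤ (1 + η) ^ 2 * ℓ := fun h => hx_star_scale hη h
  have up : ∀ {v : Fin N}, ℓ ≤ nearestDist y v → ℓ ≤ (1 + η) * nearestDist y v := fun h =>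
    h.trans (le_mul_of_one_le_left ((hℓpos.le).trans h) (by linarith))
  have E : ∀ {j l : Fin N}, (bondGraph η y).Adj j l → ℓ ≤ nearestDist y j →
      nearestDist y j ≤ (1 + η) ^ 2 * ℓ →
      (ℓ ≤ dist (y j) (y l) ∧ dist (y j) (y l) ≤ (1 + ε) * ℓ) ∧
        (ℓ ≤ dist (y l) (y j) ∧ dist (y l) (y j) ≤ (1 + ε) * ℓ) := by
    intro j l h h1 h2
    have := hx_edge hη h h1 h2
    rwa [hpow] at this
  -- `t` against `u`, `k`, `x`
  have st : ℓ ≤ (1 + η) * nearestDist y t := hx_shell_scale hη htu.symm (star hxu).1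
  have dtu := (E htu.symm (star hxu).1 (star hxu).2).2
  have dtk := (E htk.symm (star hxk).1 (star hxk).2).2
  have dtx : ℓ ≤ dist (y t) (y x) := (hx_nonbond hη hnext.symm (fun h => hnxt h.symm) st (up sx.1)).1
  have duk : ℓ ≤ dist (y u) (y k) := (hx_nonbond hη hneuk hnuk (up (star hxu).1) (up (star hxk).1)).1
  /- the labels of `u`, `k` in the chart of `x` -/
  have memS : ∀ v ∈ fccInt, ((Real.sqrt (2 : ℕ))⁻¹ • intVec v : EuclideanSpace ℝ (Fin 3)) ∈
      fccKissingPattern := fun v hv => Finset.mem_image_of_mem _ hv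
  have Z4 : ∀ v ∈ fccInt, ∀ w ∈ fccInt,
      ((bondGraph η y).Adj (m ((Real.sqrt (2 : ℕ))⁻¹ • intVec v)) (m ((Real.sqrt (2 : ℕ))⁻¹ • intVec w)) ↔
        sqNormInt (v - w) = (2 : ℕ)) := fun v hv w hw => by
    rw [C4 _ (memS v hv) _ (memS w hw), dist_scaled_intVec_eq_one_iff two_ne_zero]
  have D1 : ∀ v w : Fin 3 → ℤ, sqNormInt (v - w) = (2 : ℕ) →
      dist ((Real.sqrt (2 : ℕ))⁻¹ • intVec v : EuclideanSpace ℝ (Fin 3)) ((Real.sqrt (2 : ℕ))⁻¹ • intVec w) = 1 :=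
    fun v w h => (dist_scaled_intVec_eq_one_iff two_ne_zero v w).2 h
  obtain ⟨pu, hpu, mpu⟩ := C5 u hxu
  obtain ⟨pk, hpk, mpk⟩ := C5 k hxk
  obtain ⟨vu, hvu, rfl⟩ := Finset.mem_image.1 hpu
  obtain ⟨vk, hvk, rfl⟩ := Finset.mem_image.1 hpk
  have hneq : vu ≠ vk := by
    intro h; apply hneuk; rw [← mpu, ← mpk, h]
  have hneq' : ((Real.sqrt (2 : ℕ))⁻¹ • intVec vu : EuclideanSpace ℝ (Fin 3)) ≠ (Real.sqrt (2 : ℕ))⁻¹ • intVec vk :=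
    fun h => hneq (scaledPattern_map_injective two_ne_zero h)
  have hnc : sqNormInt (vu - vk) ≠ (2 : ℕ) := by
    intro h; apply hnuk; rw [← mpu, ← mpk]; exact (Z4 vu hvu vk hvk).2 h
  have hnc' : dist ((Real.sqrt (2 : ℕ))⁻¹ • intVec vu : EuclideanSpace ℝ (Fin 3)) ((Real.sqrt (2 : ℕ))⁻¹ • intVec vk) ≠ 1 :=
    fun h => hnc ((dist_scaled_intVec_eq_one_iff two_ne_zero vu vk).1 h)
  rcases fccInt_noncontact_cases vu hvu vk hvk hneq hnc with h4 | h6 | h8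
  · /- SQUARE DIAGONAL -/
    obtain ⟨va, hva, hua2, hak2, vb, hvb, hkb2, hbu2, hneab, hnab⟩ := fccInt_square vu hvu vk hvk h4
    have hxa : (bondGraph η y).Adj x (m ((Real.sqrt (2 : ℕ))⁻¹ • intVec va)) := (C2 _ (memS va hva)).1
    have hxb : (bondGraph η y).Adj x (m ((Real.sqrt (2 : ℕ))⁻¹ • intVec vb)) := (C2 _ (memS vb hvb)).1
    have hua : (bondGraph η y).Adj u (m ((Real.sqrt (2 : ℕ))⁻¹ • intVec va)) := by
      rw [← mpu]; exact (Z4 vu hvu va hva).2 hua2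
    have hak : (bondGraph η y).Adj (m ((Real.sqrt (2 : ℕ))⁻¹ • intVec va)) k := by
      rw [← mpk]; exact (Z4 va hva vk hvk).2 hak2
    have hkb : (bondGraph η y).Adj k (m ((Real.sqrt (2 : ℕ))⁻¹ • intVec vb)) := by
      rw [← mpk]; exact (Z4 vk hvk vb hvb).2 hkb2
    have hbu : (bondGraph η y).Adj (m ((Real.sqrt (2 : ℕ))⁻¹ • intVec vb)) u := by
      rw [← mpu]; exact (Z4 vb hvb vu hvu).2 hbu2
    have hnab' : ¬ (bondGraph η y).Adj (m ((Real.sqrt (2 : ℕ))⁻¹ • intVec va))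
        (m ((Real.sqrt (2 : ℕ))⁻¹ • intVec vb)) := fun h => hnab ((Z4 va hva vb hvb).1 h)
    have hneab' : m ((Real.sqrt (2 : ℕ))⁻¹ • intVec va) ≠ m ((Real.sqrt (2 : ℕ))⁻¹ • intVec vb) :=
      fun h => hneab (scaledPattern_map_injective two_ne_zero (C3 _ (memS va hva) _ (memS vb hvb) h))
    generalize ha : m ((Real.sqrt (2 : ℕ))⁻¹ • intVec va) = a at *
    generalize hb : m ((Real.sqrt (2 : ℕ))⁻¹ • intVec vb) = b at *
    -- the far apex
    obtain ⟨z, hzu, hza, hzk, hzb, hnxz, hnexz⟩ := hx_far_apex η hη (by linarith) N y x hnn charts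
      fccKissingPattern A m (Or.inl rfl) C2 C3 C4 C5 _ (memS vu hvu) _ (memS va hva) _ (memS vk hvk)
      _ (memS vb hvb) (D1 _ _ hua2) (D1 _ _ hak2) (D1 _ _ hkb2) (D1 _ _ hbu2) hneq' hnc'
      (fun h => hneab (scaledPattern_map_injective two_ne_zero h))
      (fun h => hnab ((dist_scaled_intVec_eq_one_iff two_ne_zero va vb).1 h))
    rw [mpu] at hzu; rw [mpk] at hzk; rw [ha] at hza; rw [hb] at hzb
    by_cases htz : t = z
    · subst htz
      exact ⟨a, hxa, hua, hak.symm, hza.symm⟩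
    · exfalso
      have sz : ℓ ≤ (1 + η) * nearestDist y z := hx_shell_scale hη hzu (star hxu).1
      have hta : a ≠ t := fun h => hnxt (h ▸ hxa)
      have htb : b ≠ t := fun h => hnxt (h ▸ hxb)
      exact hx_lens_square_dist ε ℓ hε0 hε1 hℓpos (y u) (y k) (y a) (y b) (y x) (y z) (y t)
        (E hua (star hxu).1 (star hxu).2).1.1 (E hua (star hxu).1 (star hxu).2).1.2
        (E hbu.symm (star hxu).1 (star hxu).2).1.1 (E hbu.symm (star hxu).1 (star hxu).2).1.2
        (E hak.symm (star hxk).1 (star hxk).2).1.1 (E hak.symm (star hxk).1 (star hxk).2).1.2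
        (E hkb (star hxk).1 (star hxk).2).1.1 (E hkb (star hxk).1 (star hxk).2).1.2
        (E hxa sx.1 sx.2).2.1 (E hxa sx.1 sx.2).2.2
        (E hza (star hxa).1 (star hxa).2).1.1 (E hza (star hxa).1 (star hxa).2).1.2
        (E hxb sx.1 sx.2).2.1 (E hxb sx.1 sx.2).2.2
        (E hzb (star hxb).1 (star hxb).2).1.1 (E hzb (star hxb).1 (star hxb).2).1.2
        (E hxu sx.1 sx.2).1.1 (E hxu sx.1 sx.2).1.2 (E hxk sx.1 sx.2).1.1 (E hxk sx.1 sx.2).1.2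
        (E hzu (star hxu).1 (star hxu).2).2.1 (E hzu (star hxu).1 (star hxu).2).2.2
        (E hzk (star hxk).1 (star hxk).2).2.1 (E hzk (star hxk).1 (star hxk).2).2.2
        duk (hx_nonbond hη hneab' hnab' (up (star hxa).1) (up (star hxb).1)).1
        (hx_nonbond hη hnexz hnxz (up sx.1) sz).1
        dtu.1 dtu.2 dtk.1 dtk.2 dtx (hx_distinct hta (star hxa).1).2 (hx_distinct htb (star hxb).1).2
        (hx_soft_floor hη hη1 (Ne.symm htz) sz)
  · /- HEXAGON-OPPOSITE: vacuous -/
    exfalso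
    obtain ⟨vw, hvw, hwu2, hwk2, vp, hvp, hpu2, hpw2, hpk2, hnepk, vs, hvs, hsp2, hks2, hws2, hnews, -⟩ :=
      fccInt_hexagon vu hvu vk hvk h6
    have hxw : (bondGraph η y).Adj x (m ((Real.sqrt (2 : ℕ))⁻¹ • intVec vw)) := (C2 _ (memS vw hvw)).1
    have hxp : (bondGraph η y).Adj x (m ((Real.sqrt (2 : ℕ))⁻¹ • intVec vp)) := (C2 _ (memS vp hvp)).1
    have hxs : (bondGraph η y).Adj x (m ((Real.sqrt (2 : ℕ))⁻¹ • intVec vs)) := (C2 _ (memS vs hvs)).1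
    have hwu : (bondGraph η y).Adj (m ((Real.sqrt (2 : ℕ))⁻¹ • intVec vw)) u := by
      rw [← mpu]; exact (Z4 vw hvw vu hvu).2 hwu2
    have hwk : (bondGraph η y).Adj (m ((Real.sqrt (2 : ℕ))⁻¹ • intVec vw)) k := by
      rw [← mpk]; exact (Z4 vw hvw vk hvk).2 hwk2
    have hpu' : (bondGraph η y).Adj (m ((Real.sqrt (2 : ℕ))⁻¹ • intVec vp)) u := by
      rw [← mpu]; exact (Z4 vp hvp vu hvu).2 hpu2
    have hpw : (bondGraph η y).Adj (m ((Real.sqrt (2 : ℕ))⁻¹ • intVec vp))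
        (m ((Real.sqrt (2 : ℕ))⁻¹ • intVec vw)) := (Z4 vp hvp vw hvw).2 hpw2
    have hnpk : ¬ (bondGraph η y).Adj (m ((Real.sqrt (2 : ℕ))⁻¹ • intVec vp)) k := by
      rw [← mpk]; exact fun h => hpk2 ((Z4 vp hvp vk hvk).1 h)
    have hnepk' : m ((Real.sqrt (2 : ℕ))⁻¹ • intVec vp) ≠ k := by
      rw [← mpk]
      exact fun h => hnepk (scaledPattern_map_injective two_ne_zero (C3 _ (memS vp hvp) _ (memS vk hvk) h))
    have hsp : (bondGraph η y).Adj (m ((Real.sqrt (2 : ℕ))⁻¹ • intVec vs))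
        (m ((Real.sqrt (2 : ℕ))⁻¹ • intVec vp)) := (Z4 vs hvs vp hvp).2 hsp2
    have hks : (bondGraph η y).Adj k (m ((Real.sqrt (2 : ℕ))⁻¹ • intVec vs)) := by
      rw [← mpk]; exact (Z4 vk hvk vs hvs).2 hks2
    have hnws : ¬ (bondGraph η y).Adj (m ((Real.sqrt (2 : ℕ))⁻¹ • intVec vw))
        (m ((Real.sqrt (2 : ℕ))⁻¹ • intVec vs)) := fun h => hws2 ((Z4 vw hvw vs hvs).1 h)
    have hnews' : m ((Real.sqrt (2 : ℕ))⁻¹ • intVec vw) ≠ m ((Real.sqrt (2 : ℕ))⁻¹ • intVec vs) :=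
      fun h => hnews (scaledPattern_map_injective two_ne_zero (C3 _ (memS vw hvw) _ (memS vs hvs) h))
    -- the far apex of the square `p w k s`
    obtain ⟨z, hzp, hzw, hzk, hzs, hnxz, hnexz⟩ := hx_far_apex η hη (by linarith) N y x hnn charts
      fccKissingPattern A m (Or.inl rfl) C2 C3 C4 C5 _ (memS vp hvp) _ (memS vw hvw) _ (memS vk hvk)
      _ (memS vs hvs) (D1 _ _ hpw2) (D1 _ _ hwk2) (D1 _ _ hks2) (D1 _ _ hsp2)
      (fun h => hnepk (scaledPattern_map_injective two_ne_zero h))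
      (fun h => hpk2 ((dist_scaled_intVec_eq_one_iff two_ne_zero vp vk).1 h))
      (fun h => hnews (scaledPattern_map_injective two_ne_zero h))
      (fun h => hws2 ((dist_scaled_intVec_eq_one_iff two_ne_zero vw vs).1 h))
    rw [mpk] at hzk
    generalize hw : m ((Real.sqrt (2 : ℕ))⁻¹ • intVec vw) = w at *
    generalize hp : m ((Real.sqrt (2 : ℕ))⁻¹ • intVec vp) = p at *
    generalize hs : m ((Real.sqrt (2 : ℕ))⁻¹ • intVec vs) = s at *
    have sz : ℓ ≤ (1 + η) * nearestDist y z := hx_shell_scale hη hzp (star hxp).1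
    -- the octahedron `{x, z; p, k; w, s}` pins `dist p k`
    obtain ⟨-, -, -, ⟨dlo, dhi⟩, -, -⟩ := metric_octahedron_dist ε ℓ hε0 (hε1.trans (by norm_num)) hℓpos
      (y p) (y k) (y w) (y s) (y x) (y z)
      (E hpw (star hxp).1 (star hxp).2).1.1 (E hpw (star hxp).1 (star hxp).2).1.2
      (E hsp.symm (star hxp).1 (star hxp).2).1.1 (E hsp.symm (star hxp).1 (star hxp).2).1.2
      (E hwk.symm (star hxk).1 (star hxk).2).1.1 (E hwk.symm (star hxk).1 (star hxk).2).1.2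
      (E hks (star hxk).1 (star hxk).2).1.1 (E hks (star hxk).1 (star hxk).2).1.2
      (E hxw sx.1 sx.2).2.1 (E hxw sx.1 sx.2).2.2
      (E hzw (star hxw).1 (star hxw).2).1.1 (E hzw (star hxw).1 (star hxw).2).1.2
      (E hxs sx.1 sx.2).2.1 (E hxs sx.1 sx.2).2.2
      (E hzs (star hxs).1 (star hxs).2).1.1 (E hzs (star hxs).1 (star hxs).2).1.2
      (E hxp sx.1 sx.2).1.1 (E hxp sx.1 sx.2).1.2 (E hxk sx.1 sx.2).1.1 (E hxk sx.1 sx.2).1.2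
      (E hzp (star hxp).1 (star hxp).2).2.1 (E hzp (star hxp).1 (star hxp).2).2.2
      (E hzk (star hxk).1 (star hxk).2).2.1 (E hzk (star hxk).1 (star hxk).2).2.2
      (hx_nonbond hη hnepk' hnpk (up (star hxp).1) (up (star hxk).1)).1
      (hx_nonbond hη hnews' hnws (up (star hxw).1) (up (star hxs).1)).1
      (hx_nonbond hη hnexz hnxz (up sx.1) sz).1
    have htw : w ≠ t := fun h => hnxt (h ▸ hxw)
    exact hx_lens_hexagon_dist ε ℓ hε0 hε1 hℓpos (y x) (y w) (y u) (y p) (y k) (y t)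
      (E hxw sx.1 sx.2).1.1 (E hxw sx.1 sx.2).1.2
      (E hxu sx.1 sx.2).2.1 (E hxu sx.1 sx.2).2.2
      (E hwu.symm (star hxu).1 (star hxu).2).1.1 (E hwu.symm (star hxu).1 (star hxu).2).1.2
      (E hxp sx.1 sx.2).2.1 (E hxp sx.1 sx.2).2.2
      (E hpw (star hxp).1 (star hxp).2).1.1 (E hpw (star hxp).1 (star hxp).2).1.2
      (E hxk sx.1 sx.2).2.1 (E hxk sx.1 sx.2).2.2
      (E hwk.symm (star hxk).1 (star hxk).2).1.1 (E hwk.symm (star hxk).1 (star hxk).2).1.2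
      (E hpu'.symm (star hxu).1 (star hxu).2).1.1 (E hpu'.symm (star hxu).1 (star hxu).2).1.2
      dlo dhi duk dtu.1 dtu.2 dtk.1 dtk.2 dtx (hx_distinct htw (star hxw).1).2
  · /- ANTIPODAL: vacuous -/
    exfalso
    have hk' := fccInt_antipodal vu hvu vk hvk h8
    have eneg : ((Real.sqrt (2 : ℕ))⁻¹ • intVec vk : EuclideanSpace ℝ (Fin 3)) =
        -((Real.sqrt (2 : ℕ))⁻¹ • intVec vu) := by
      rw [hk', ← smul_neg]
      congr 1
      ext i
      simp [intVec]
    have cu := (C2 _ (memS vu hvu)).2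
    have ck := (C2 _ (memS vk hvk)).2
    rw [mpu] at cu
    rw [mpk, eneg, map_neg, smul_neg, ← sub_eq_add_neg] at ck
    have he : ‖A ((Real.sqrt (2 : ℕ))⁻¹ • intVec vu)‖ = 1 := by
      rw [A.norm_map]; exact norm_eq_one_of_mem_fccKissingPattern (memS vu hvu)
    have h12 : (1 + η) ^ 2 ≤ 26 / 25 := by nlinarith
    have hnn0 := nearestDist_nonneg y x
    have dtu' : dist (y t) (y u) ≤ 26 / 25 * nearestDist y x := by
      have h1 := dist_le_of_adj hρ.le htu.symm
      rw [dist_comm] at h1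
      have h2 := (star hxu).2
      have h3 : (1 + η) ^ 2 * ℓ = (1 + η) * nearestDist y x := by rw [hℓ]; field_simp
      nlinarith [dist_nonneg (x := y t) (y := y u)]
    have dtk' : dist (y t) (y k) ≤ 26 / 25 * nearestDist y x := by
      have h1 := dist_le_of_adj hρ.le htk.symm
      rw [dist_comm] at h1
      have h2 := (star hxk).2
      have h3 : (1 + η) ^ 2 * ℓ = (1 + η) * nearestDist y x := by rw [hℓ]; field_simp
      nlinarith [dist_nonneg (x := y t) (y := y k)]
    have hlt := hx_antipodal (nearestDist y x) (y x) (A ((Real.sqrt (2 : ℕ))⁻¹ • intVec vu)) (y u) (y k) (y t)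
      hnn he cu ck dtu' dtk'
    exact absurd (nearestDist_le_dist y (j := x) (k := t) hnext.symm) (not_le.2 hlt)


end Summit.AtomisticToContinuum.Crystallization.Theorems

end
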